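import Literature.Geometry.Riemannian.HeatKernelGradientEstimate
import Literature.MeasureTheory.Integral.BoundedMeasurableApproximation
import HarnessLib

/-!
# The strong Feller property of the heat kernel measures of a Ricci flow
# (Bamler 2023, §3.1, Def. 3.2 and the remark after it; §3.7)

For a `C^∞` family `h` of Riemannian metrics on a closed manifold `M` (modelled on `ℝᵐ`) which is
a Ricci flow on `[s, t]`, the heat kernel measures `ν_{x,r;s}` (`heatKernelMeasure`,
`HeatKernelMeasures.lean`) regularise bounded measurable data: by Bamler's gradient estimate
(`IsRicciFlow.ofReal_abs_integral_sub_integral_le`, `HeatKernelGradientEstimate.lean`, the case of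
smooth data) and two approximation steps — smooth → continuous (uniform density of `C^∞(M)` in
`C(M)`) and continuous → bounded measurable (`BoundedMeasurableApproximation.lean`, density of
`C(M)` in `L¹(ν_{x,r;s} + ν_{y,r;s})`) — we prove, for `s < r ≤ t`:

* `IsRicciFlow.ofReal_abs_integral_sub_integral_le_of_continuous`,
  `IsRicciFlow.ofReal_abs_integral_sub_integral_le_of_measurable` — for continuous, resp. bounded
  measurable, `φ` with `|φ| ≤ B`:
  `|∫ φ dν_{x,r;s} − ∫ φ dν_{y,r;s}| ≤ B (π (r − s))^{-1/2} d_{h(r)}(x, y)`;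
* `IsRicciFlow.ofReal_abs_measureReal_sub_measureReal_le` — for a Borel set `S`:
  `|ν_{x,r;s}(S) − ν_{y,r;s}(S)| ≤ ½ (π (r − s))^{-1/2} d_{h(r)}(x, y)`;
* `IsRicciFlow.continuous_integral_heatKernelMeasure_of_measurable`,
  `IsRicciFlow.continuous_heatKernelMeasure_apply` — hence `x ↦ ∫ φ dν_{x,r;s}` and
  `x ↦ ν_{x,r;s}(S)` are continuous for bounded measurable `φ` and Borel `S` (the **strong Feller
  property**; Bamler 2023, remark after Def. 3.2: "the integrand `y ↦ ν_{y;t₁}(S)` is continuous if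
  `t₁ < t₂`").

Everything is proved; no definitions, no named facts.

## References

* R. H. Bamler, *Compactness theory of the space of super Ricci flows*, Invent. Math. 233 (2023),
  1121–1277, §3.1, Def. 3.2 (6) and the remark following it; §3.7. [Bamler2023]
* R. H. Bamler, *Entropy and heat kernel bounds on a Ricci flow background*, arXiv:2008.07093
  (2020), Thm. 4.1. [Bamler2020Entropy]
-/

noncomputable section

open Bundle Set Function Filter Manifold MeasureTheory Measure TopologicalSpace
open scoped Manifold ContDiff Topology ENNReal NNReal

namespace Literature.Geometry.Riemannian

open Lorentzian Lorentzian.PseudoRiemannianMetric MetricFlow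
open Literature.MeasureTheory.Integral

section StrongFeller

variable {m : ℕ} {H : Type*} [TopologicalSpace H]
  {I : ModelWithCorners ℝ (EuclideanSpace ℝ (Fin m)) H} [I.Boundaryless]
  {M : Type*} [TopologicalSpace M] [ChartedSpace H M] [IsManifold I ∞ M]
  [T2Space M] [CompactSpace M] [SecondCountableTopology M] [MeasurableSpace M] [BorelSpace M]
  {h : ℝ → PseudoRiemannianMetric I ∞ (EuclideanSpace ℝ (Fin m)) (TangentSpace I : M → Type _)}
  (hh : IsContMDiffFamilyOn ∞ h univ) (hR : ∀ r, (h r).IsRiemannian)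

/-- The integral of a bounded function against a heat kernel measure changes by at most `ε` when
the integrand changes by at most `ε` uniformly (probability measure). [folklore] -/
theorem abs_integral_heatKernelMeasure_sub_integral_le (r : ℝ) (x : M) (s : ℝ) {φ ψ : M → ℝ}
    (hφ : Integrable φ (heatKernelMeasure hh hR r x s))
    (hψ : Integrable ψ (heatKernelMeasure hh hR r x s)) {ε : ℝ} (hε : ∀ y, |φ y - ψ y| ≤ ε) :
    |∫ y, φ y ∂(heatKernelMeasure hh hR r x s) - ∫ y, ψ y ∂(heatKernelMeasure hh hR r x s)| ≤ ε := by
  rw [← integral_sub hφ hψ]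
  have key := norm_integral_le_of_norm_le_const (μ := heatKernelMeasure hh hR r x s)
    (f := fun y ↦ φ y - ψ y) (C := ε) (Eventually.of_forall fun y ↦ by
      rw [Real.norm_eq_abs]; exact hε y)
  simpa [Real.norm_eq_abs] using key

/-- **The Lipschitz bound for continuous data.** For a continuous `φ` with `|φ| ≤ B`, `B > 0`,
and `s < r ≤ t`: `|∫ φ dν_{x,r;s} − ∫ φ dν_{y,r;s}| ≤ B (π (r − s))^{-1/2} d_{h(r)}(x, y)`
(smooth uniform approximants `ψ` with `|ψ − φ| < ε'`, `|ψ| ≤ B + ε'`, the smooth case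
`IsRicciFlow.ofReal_abs_integral_sub_integral_le`, and `ε' → 0`). [cite: Bamler2023, §3.1, Def. 3.2 (6)] -/
theorem IsRicciFlow.ofReal_abs_integral_sub_integral_le_of_continuous {s t : ℝ} (hst : s < t)
    {cov : ℝ → CovariantDerivative I (EuclideanSpace ℝ (Fin m)) (TangentSpace I : M → Type _)}
    (hflow : IsRicciFlow h cov (Icc s t))
    {φ : M → ℝ} (hφ : Continuous φ) {B : ℝ} (hB : 0 < B) (hφB : ∀ x, |φ x| ≤ B)
    {r : ℝ} (hr : r ∈ Ioc s t) (x y : M) :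
    ENNReal.ofReal |∫ z, φ z ∂(heatKernelMeasure hh hR r x s) -
        ∫ z, φ z ∂(heatKernelMeasure hh hR r y s)| ≤
      ENNReal.ofReal (B * (1 / Real.sqrt (Real.pi * (r - s)))) * (h r).edist (hR r) x y := by
  set κ : ℝ := 1 / Real.sqrt (Real.pi * (r - s)) with hκdef
  have hrs : 0 < r - s := sub_pos.2 hr.1
  have hκ : 0 < κ := by positivity
  set d := (h r).edist (hR r) x y with hd
  rcases eq_or_ne d ⊤ with hdt | hdt
  · rw [hdt, ENNReal.mul_top (by simpa using mul_pos hB hκ)]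
    exact le_top
  -- finite distance: a real inequality, proved up to an arbitrary `ε > 0`
  have hφi : ∀ z, Integrable φ (heatKernelMeasure hh hR r z s) := fun z ↦
    hφ.integrable_of_hasCompactSupport (HasCompactSupport.of_compactSpace φ)
  have hreal : |∫ z, φ z ∂(heatKernelMeasure hh hR r x s) -
      ∫ z, φ z ∂(heatKernelMeasure hh hR r y s)| ≤ B * κ * d.toReal := by
    refine le_of_forall_pos_le_add fun ε hε ↦ ?_
    -- smooth approximant within `ε'`, `ε' (κ d + 2) = ε`
    set ε' : ℝ := ε / (κ * d.toReal + 2) with hε'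
    have hden : 0 < κ * d.toReal + 2 := by positivity
    have hε'0 : 0 < ε' := div_pos hε hden
    obtain ⟨ψ, hψs, hψφ⟩ := exists_contMDiff_abs_sub_lt I hφ hε'0
    have hψB : ∀ z, |ψ z| ≤ B + ε' := fun z ↦ by
      have h1 := hψφ z
      have h2 := hφB z
      calc |ψ z| = |(ψ z - φ z) + φ z| := by ring_nf
        _ ≤ |ψ z - φ z| + |φ z| := abs_add_le _ _
        _ ≤ B + ε' := by linarith
    have hψi : ∀ z, Integrable ψ (heatKernelMeasure hh hR r z s) := fun z ↦
      hψs.continuous.integrable_of_hasCompactSupport (HasCompactSupport.of_compactSpace ψ)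
    -- the smooth case
    have hsm := hflow.ofReal_abs_integral_sub_integral_le hh hR hst hψs (by linarith) hψB hr x y
    rw [← hd, ← ENNReal.ofReal_toReal hdt, ← ENNReal.ofReal_mul' ENNReal.toReal_nonneg,
      ENNReal.ofReal_le_ofReal_iff (by positivity)] at hsm
    -- the two approximation errors
    have ex := abs_integral_heatKernelMeasure_sub_integral_le hh hR r x s (hφi x) (hψi x)
      (ε := ε') (fun z ↦ by rw [abs_sub_comm]; exact (hψφ z).le)
    have ey := abs_integral_heatKernelMeasure_sub_integral_le hh hR r y s (hφi y) (hψi y)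
      (ε := ε') (fun z ↦ by rw [abs_sub_comm]; exact (hψφ z).le)
    have hsplit : ∫ z, φ z ∂(heatKernelMeasure hh hR r x s) -
        ∫ z, φ z ∂(heatKernelMeasure hh hR r y s) =
        (∫ z, φ z ∂(heatKernelMeasure hh hR r x s) - ∫ z, ψ z ∂(heatKernelMeasure hh hR r x s)) +
        (∫ z, ψ z ∂(heatKernelMeasure hh hR r x s) - ∫ z, ψ z ∂(heatKernelMeasure hh hR r y s)) -
        (∫ z, φ z ∂(heatKernelMeasure hh hR r y s) -
          ∫ z, ψ z ∂(heatKernelMeasure hh hR r y s)) := by ring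
    have hεid : (B + ε') * κ * d.toReal + ε' + ε' = B * κ * d.toReal + ε := by
      have : ε' * (κ * d.toReal + 2) = ε := by rw [hε', div_mul_cancel₀ _ hden.ne']
      linarith
    rw [hsplit]
    calc |_ + _ - _| ≤ |∫ z, φ z ∂(heatKernelMeasure hh hR r x s) -
            ∫ z, ψ z ∂(heatKernelMeasure hh hR r x s)| +
          |∫ z, ψ z ∂(heatKernelMeasure hh hR r x s) -
            ∫ z, ψ z ∂(heatKernelMeasure hh hR r y s)| +
          |∫ z, φ z ∂(heatKernelMeasure hh hR r y s) -
            ∫ z, ψ z ∂(heatKernelMeasure hh hR r y s)| :=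
          (abs_sub _ _).trans (add_le_add (abs_add_le _ _) le_rfl)
      _ ≤ ε' + (B + ε') * κ * d.toReal + ε' := by gcongr
      _ = B * κ * d.toReal + ε := by linarith
  calc ENNReal.ofReal _ ≤ ENNReal.ofReal (B * κ * d.toReal) := ENNReal.ofReal_le_ofReal hreal
    _ = ENNReal.ofReal (B * κ) * d := by
      rw [ENNReal.ofReal_mul' ENNReal.toReal_nonneg, ENNReal.ofReal_toReal hdt]

/-- **The Lipschitz bound for bounded measurable data (strong Feller, quantitative).** For a
measurable `φ` with `|φ| ≤ B` and `s < r ≤ t`: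
`|∫ φ dν_{x,r;s} − ∫ φ dν_{y,r;s}| ≤ B (π (r − s))^{-1/2} d_{h(r)}(x, y)` (the continuous case
and the density of `C(M)` in `L¹(ν_{x,r;s} + ν_{y,r;s})`,
`abs_integral_sub_integral_le_mul_of_forall_continuous`). [cite: Bamler2023, §3.1, Def. 3.2 (6)] -/
theorem IsRicciFlow.ofReal_abs_integral_sub_integral_le_of_measurable {s t : ℝ} (hst : s < t)
    {cov : ℝ → CovariantDerivative I (EuclideanSpace ℝ (Fin m)) (TangentSpace I : M → Type _)}
    (hflow : IsRicciFlow h cov (Icc s t))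
    {φ : M → ℝ} (hφm : Measurable φ) {B : ℝ} (hB : 0 ≤ B) (hφB : ∀ x, |φ x| ≤ B)
    {r : ℝ} (hr : r ∈ Ioc s t) (x y : M) :
    ENNReal.ofReal |∫ z, φ z ∂(heatKernelMeasure hh hR r x s) -
        ∫ z, φ z ∂(heatKernelMeasure hh hR r y s)| ≤
      ENNReal.ofReal (B * (1 / Real.sqrt (Real.pi * (r - s)))) * (h r).edist (hR r) x y := by
  haveI : MetrizableSpace M := Manifold.metrizableSpace I M
  set κ : ℝ := 1 / Real.sqrt (Real.pi * (r - s)) with hκdef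
  have hrs : 0 < r - s := sub_pos.2 hr.1
  have hκ : 0 < κ := by positivity
  set d := (h r).edist (hR r) x y with hd
  -- `B = 0`: `φ = 0`
  rcases hB.eq_or_lt with hB0 | hB0
  · subst hB0
    have hφ0 : ∀ z, φ z = 0 := fun z ↦ abs_nonpos_iff.1 (hφB z)
    simp [hφ0]
  rcases eq_or_ne d ⊤ with hdt | hdt
  · rw [hdt, ENNReal.mul_top (by simpa using mul_pos hB0 hκ)]
    exact le_top
  -- the bound on continuous test functions with `|g| ≤ 1`
  have hC : ∀ g : M → ℝ, Continuous g → (∀ z, |g z| ≤ 1) →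
      |∫ z, g z ∂(heatKernelMeasure hh hR r x s) - ∫ z, g z ∂(heatKernelMeasure hh hR r y s)| ≤
        κ * d.toReal := by
    intro g hg hg1
    have key := hflow.ofReal_abs_integral_sub_integral_le_of_continuous hh hR hst hg one_pos hg1
      hr x y
    rwa [one_mul, ← hd, ← ENNReal.ofReal_toReal hdt, ← ENNReal.ofReal_mul' ENNReal.toReal_nonneg,
      ENNReal.ofReal_le_ofReal_iff (by positivity)] at key
  have key := abs_integral_sub_integral_le_mul_of_forall_continuous
    (heatKernelMeasure hh hR r x s) (heatKernelMeasure hh hR r y s) hC hφm hB hφB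
  calc ENNReal.ofReal _ ≤ ENNReal.ofReal (κ * d.toReal * B) := ENNReal.ofReal_le_ofReal key
    _ = ENNReal.ofReal (B * κ) * d := by
      rw [show κ * d.toReal * B = B * κ * d.toReal by ring,
        ENNReal.ofReal_mul' ENNReal.toReal_nonneg, ENNReal.ofReal_toReal hdt]

/-- **The heat kernel measures of nearby points are close on every Borel set**: for `s < r ≤ t`
and a Borel set `S`, `|ν_{x,r;s}(S) − ν_{y,r;s}(S)| ≤ ½ (π (r − s))^{-1/2} d_{h(r)}(x, y)`
(`abs_measureReal_sub_measureReal_le_of_forall_continuous`; both are probability measures).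
[cite: Bamler2023, §3.1, Def. 3.2 and remark] -/
theorem IsRicciFlow.ofReal_abs_measureReal_sub_measureReal_le {s t : ℝ} (hst : s < t)
    {cov : ℝ → CovariantDerivative I (EuclideanSpace ℝ (Fin m)) (TangentSpace I : M → Type _)}
    (hflow : IsRicciFlow h cov (Icc s t)) {S : Set M} (hS : MeasurableSet S)
    {r : ℝ} (hr : r ∈ Ioc s t) (x y : M) :
    ENNReal.ofReal |(heatKernelMeasure hh hR r x s).real S - (heatKernelMeasure hh hR r y s).real S| ≤
      ENNReal.ofReal (1 / 2 * (1 / Real.sqrt (Real.pi * (r - s)))) * (h r).edist (hR r) x y := by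
  haveI : MetrizableSpace M := Manifold.metrizableSpace I M
  set κ : ℝ := 1 / Real.sqrt (Real.pi * (r - s)) with hκdef
  have hrs : 0 < r - s := sub_pos.2 hr.1
  have hκ : 0 < κ := by positivity
  set d := (h r).edist (hR r) x y with hd
  rcases eq_or_ne d ⊤ with hdt | hdt
  · rw [hdt, ENNReal.mul_top (by simpa using hκ)]
    exact le_top
  have hC : ∀ g : M → ℝ, Continuous g → (∀ z, |g z| ≤ 1) →
      |∫ z, g z ∂(heatKernelMeasure hh hR r x s) - ∫ z, g z ∂(heatKernelMeasure hh hR r y s)| ≤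
        κ * d.toReal := by
    intro g hg hg1
    have key := hflow.ofReal_abs_integral_sub_integral_le_of_continuous hh hR hst hg one_pos hg1
      hr x y
    rwa [one_mul, ← hd, ← ENNReal.ofReal_toReal hdt, ← ENNReal.ofReal_mul' ENNReal.toReal_nonneg,
      ENNReal.ofReal_le_ofReal_iff (by positivity)] at key
  have huniv : heatKernelMeasure hh hR r x s univ = heatKernelMeasure hh hR r y s univ := by
    rw [measure_univ, measure_univ]
  have key := abs_measureReal_sub_measureReal_le_of_forall_continuous
    (heatKernelMeasure hh hR r x s) (heatKernelMeasure hh hR r y s) hC huniv hS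
  calc ENNReal.ofReal _ ≤ ENNReal.ofReal (κ * d.toReal / 2) := ENNReal.ofReal_le_ofReal key
    _ = ENNReal.ofReal (1 / 2 * κ) * d := by
      rw [show κ * d.toReal / 2 = 1 / 2 * κ * d.toReal by ring,
        ENNReal.ofReal_mul' ENNReal.toReal_nonneg, ENNReal.ofReal_toReal hdt]

omit [I.Boundaryless] [SecondCountableTopology M] [MeasurableSpace M] [BorelSpace M] in
/-- A function which is Lipschitz for the Riemannian distance of a Riemannian metric `g` on `M`
(in the extended form `ofReal |F x − F y| ≤ ofReal L · d_g(x, y)`) is continuous for the manifold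
topology (`d_g(x, ·) → 0` at `x`, `PseudoRiemannianMetric.tendsto_edist_nhds`). [folklore] -/
theorem continuous_of_ofReal_abs_sub_le_mul_edist
    (g : PseudoRiemannianMetric I ∞ (EuclideanSpace ℝ (Fin m)) (TangentSpace I : M → Type _))
    (hg : g.IsRiemannian) {F : M → ℝ} {L : ℝ}
    (hF : ∀ x y, ENNReal.ofReal |F x - F y| ≤ ENNReal.ofReal L * g.edist hg x y) :
    Continuous F := by
  refine continuous_iff_continuousAt.2 fun x ↦ ?_
  rw [ContinuousAt, tendsto_iff_norm_sub_tendsto_zero]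
  -- `‖F y - F x‖ ≤ (ofReal L * d(x, y)).toReal → 0`
  have hlim : Tendsto (fun y ↦ (ENNReal.ofReal L * g.edist hg x y).toReal) (𝓝 x) (𝓝 0) := by
    have h1 : Tendsto (fun y ↦ ENNReal.ofReal L * g.edist hg x y) (𝓝 x) (𝓝 0) := by
      simpa using ENNReal.Tendsto.const_mul (PseudoRiemannianMetric.tendsto_edist_nhds hg x)
        (Or.inr ENNReal.ofReal_ne_top)
    have h2 := (ENNReal.tendsto_toReal ENNReal.zero_ne_top).comp h1
    rw [ENNReal.toReal_zero] at h2
    exact h2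
  have hev : ∀ᶠ y in 𝓝 x, g.edist hg x y < ⊤ := by
    have := PseudoRiemannianMetric.tendsto_edist_nhds hg x
    exact this (Iio_mem_nhds ENNReal.zero_lt_top)
  refine squeeze_zero' (Eventually.of_forall fun y ↦ norm_nonneg _) ?_ hlim
  filter_upwards [hev] with y hy
  have key := hF y x
  rw [PseudoRiemannianMetric.edist_comm] at key
  have hne : ENNReal.ofReal L * g.edist hg x y ≠ ⊤ := ENNReal.mul_ne_top ENNReal.ofReal_ne_top hy.ne
  rw [Real.norm_eq_abs]
  exact (ENNReal.ofReal_le_iff_le_toReal hne).1 key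

/-- **Strong Feller property**: for bounded measurable `φ` and `s < r ≤ t`, the function
`x ↦ ∫ φ dν_{x,r;s}` is continuous (Bamler 2023, remark after Def. 3.2; here from the quantitative
Lipschitz bound). [cite: Bamler2023, §3.1, Def. 3.2 and remark] -/
theorem IsRicciFlow.continuous_integral_heatKernelMeasure_of_measurable {s t : ℝ} (hst : s < t)
    {cov : ℝ → CovariantDerivative I (EuclideanSpace ℝ (Fin m)) (TangentSpace I : M → Type _)}
    (hflow : IsRicciFlow h cov (Icc s t))
    {φ : M → ℝ} (hφm : Measurable φ) {B : ℝ} (hφB : ∀ x, |φ x| ≤ B)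
    {r : ℝ} (hr : r ∈ Ioc s t) :
    Continuous fun x ↦ ∫ z, φ z ∂(heatKernelMeasure hh hR r x s) := by
  cases isEmpty_or_nonempty M with
  | inl hM => exact continuous_of_discreteTopology
  | inr hM =>
    have hB : 0 ≤ B := (abs_nonneg _).trans (hφB (Classical.arbitrary M))
    exact continuous_of_ofReal_abs_sub_le_mul_edist (h r) (hR r)
      (fun x y ↦ hflow.ofReal_abs_integral_sub_integral_le_of_measurable hh hR hst hφm hB hφB hr x y)

/-- **Strong Feller property on Borel sets**: for `s < r ≤ t` and a Borel set `S`, the function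
`x ↦ ν_{x,r;s}(S)` is continuous ("the integrand `y ↦ ν_{y;t₁}(S)` is continuous if `t₁ < t₂`",
Bamler 2023, remark after Def. 3.2). [cite: Bamler2023, §3.1, Def. 3.2 and remark] -/
theorem IsRicciFlow.continuous_heatKernelMeasure_apply {s t : ℝ} (hst : s < t)
    {cov : ℝ → CovariantDerivative I (EuclideanSpace ℝ (Fin m)) (TangentSpace I : M → Type _)}
    (hflow : IsRicciFlow h cov (Icc s t)) {S : Set M} (hS : MeasurableSet S)
    {r : ℝ} (hr : r ∈ Ioc s t) :
    Continuous fun x ↦ heatKernelMeasure hh hR r x s S := by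
  have hreal : Continuous fun x ↦ (heatKernelMeasure hh hR r x s).real S :=
    continuous_of_ofReal_abs_sub_le_mul_edist (h r) (hR r)
      (fun x y ↦ hflow.ofReal_abs_measureReal_sub_measureReal_le hh hR hst hS hr x y)
  have e : (fun x ↦ heatKernelMeasure hh hR r x s S) =
      fun x ↦ ENNReal.ofReal ((heatKernelMeasure hh hR r x s).real S) := by
    funext x
    rw [measureReal_def, ENNReal.ofReal_toReal (measure_ne_top _ _)]
  rw [e]
  exact ENNReal.continuous_ofReal.comp hreal

end StrongFeller

end Literature.Geometry.Riemannian
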